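/-
Copyright (c) 2026 the pub-hodgecm-mathlib formalisation cell (harness21).  Prover seat hodgecm-mathlib-K2Liu-p05 (g3), 2026-09-04
(Track B «K2-LIT», crux hLiu418 = stmt-HodgeConjecture-24832, socket #42F′, ROAD I v3, organ G2-Weil, sub-organ (G2-W2) completed:
the (G2.2) face along EVERY `X ∈ 𝔲(2,2)` — linearity of the Lie derivative in `X`).
-/
import Summits.HodgeConjecture.HodgeConjecture.Theorems.K2LiuWeilDatumSmoothU22                -- (G2-W2): `contDiffAt_weilDatum_inl`, letter derivatives
import Literature.NumberTheory.Automorphic.RealMatrixGroupCharacterSmooth                     -- ★ `contDiffAt_coe_expMem_mk` (`exp` is smooth on `𝔤`)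
import HarnessLib

/-!
# (G2-W2, completed) The Lie derivative of an archimedean Weil datum of `U(2,2) × U(R,S)` along EVERY `X ∈ 𝔲(2,2)`:
# `d∕dt|₀ T (ω (exp (t X), 1) Φ) = ∑ᵢ aᵢ(X) · T (dωᵢ Φ)`, `aᵢ(X)` the coordinates of `X` in the adapted basis

Track B ∕ K2-LIT, hLiu418 = stmt-HodgeConjecture-24832, #42F′ ROAD I v3 organ G2-Weil (SIGS-RoadI-v3 §G2 (G2.2): the `hXφ`-producer for G1.1 ∕ G2-PS of
K2Liu-p08).  Namespace `Summit.HodgeConjecture.HodgeConjecture.Cruxes.HLiu418.K2LiuWeilDatumSmoothU22` (continued).  THEOREMS ONLY (no definition, no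
instance, no notation, no named fact, no `sorry`); the Mathlib idiom `attribute [local instance 100] LieRing.ofAssociativeRing` as in (G2-W2);
`--supports stmt-HodgeConjecture-24832 --as helper`.

(G2-W2) ★ `hasDerivAt_weilDatum_expMem_smul_u22X` differentiates `t ↦ T (ω (exp (t X_i), 1) Φ)` along the sixteen ADAPTED BASIS VECTORS `X_i` of `𝔲(2,2)`
(★ `u22AdaptedBasis`), with the explicit Schwartz derivative vectors `dωᵢ Φ := κOp e (kᵢ,1) (Gᵢ (κOp e (kᵢ⁻¹,1) Φ))`.  This file extends it to EVERY
`X ∈ 𝔲(2,2)` by LINEARITY OF THE DIFFERENTIAL AT THE IDENTITY: the map `F : 𝔤 → V`, `Y ↦ T (ω (exp Y, 1) Φ)` is `C^∞` on the normed space `𝔤 = 𝔲(2,2)`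
(★ `contDiffAt_weilDatum_inl` along `Y ↦ exp Y`, which is smooth as a matrix-valued map: ★ `RealMatrixGroup.contDiffAt_coe_expMem_mk`), so
`t ↦ F (t X)` has derivative `DF(0) X = ∑ᵢ aᵢ(X) DF(0) X_i` at `0` (chain rule + linearity of `DF(0)`), and `DF(0) X_i = T (dωᵢ Φ)` by uniqueness of
derivatives against (G2-W2):

* **`hasDerivAt_weilDatum_expMem_smul`** — for every `X ∈ 𝔲(2,2)`:
  `HasDerivAt (fun t => T (ω (expMem (t • X), 1) Φ)) (∑ i, (u22AdaptedBasis.repr X) i • T (dωᵢ Φ)) 0`;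
* **`hasDerivAt_weilDatum_expMem_smul'`** — the same with the derivative written as `T` of ONE Schwartz vector,
  `T (∑ i, ((u22AdaptedBasis.repr X) i : ℂ) • dωᵢ Φ)` (`T` real-linear; real scalars commute with `T`) — the shape `HasDerivAt (…) (T (dω X Φ)) 0` of the
  SIGS §G2 (G2.2) face, `dω X Φ := ∑ i aᵢ(X) • dωᵢ Φ ∈ 𝓢`.

HONEST LABEL: HC_CM is proved only modulo the 7 printed citations (2 remaining named inputs: hLiu418 = stmt-HodgeConjecture-24832, h413 =
stmt-HodgeConjecture-24833) until rung 0 closes; organ capital for #42F′'s Road I, moves no counter.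

## References
* [Varadarajan1984] V. S. Varadarajan, *Lie Groups, Lie Algebras, and Their Representations* (1984), Thm. 2.10.1, (2.10.19).
* [Folland1989] G. B. Folland, *Harmonic Analysis in Phase Space* (1989), §4.2, (4.24), Prop. (4.39).
-/

set_option autoImplicit false
set_option linter.dupNamespace false

noncomputable section

open scoped MatrixGroups Matrix Topology SchwartzMap Matrix.Norms.Operator
open Filter
open Literature.NumberTheory.Automorphic Literature.Analysis.SegalBargmann Literature.NumberTheory.Weil1964
open Literature.RepresentationTheory.KonnoKonno2007 hiding LetterKind letterOf letterGen letterOf_boost letterOf_torus letterOf_torus_eq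
  letterGen_boost letterGen_torus letterGen_mem_lie exp_smul_letterGen
open Literature.RepresentationTheory.KonnoKonno2007.RealDualPair
open Literature.RepresentationTheory.KonnoKonno2007.RealDualPair.UForm
open Summit.HodgeConjecture.HodgeConjecture.Cruxes.HLiu418.K2LiuU22AdaptedBasis

-- Mathlib idiom (`Mathlib/Algebra/Lie/OfAssociative.lean`), as in ★ `RealMatrixGroups` ∕ ★ `JunctionArchDifferentiable`: the commutator bracket on
-- `Matrix n n ℂ`, needed to name the Lie subalgebra `(uFormGroup (Fin 2) (Fin 2)).lie`
attribute [local instance 100] LieRing.ofAssociativeRing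

namespace Summit.HodgeConjecture.HodgeConjecture.Cruxes.HLiu418.K2LiuWeilDatumSmoothU22

variable {R S : Type*} [Fintype R] [DecidableEq R] [Fintype S] [DecidableEq S]
  {V : Type*} [NormedAddCommGroup V] [NormedSpace ℝ V]

/-- `u22X i` is the `i`-th adapted basis vector read in the Lie algebra (same matrix: ★ `coe_u22X_eq`). [folklore] -/
theorem u22X_eq_mk_u22AdaptedBasis (i : Fin 16) :
    u22X i = ⟨((u22AdaptedBasis i : ↥(uFormGroup (Fin 2) (Fin 2)).lie.toSubmodule) : Matrix (Fin 2 ⊕ Fin 2) (Fin 2 ⊕ Fin 2) ℂ),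
      (u22AdaptedBasis i).2⟩ :=
  Subtype.ext (coe_u22X_eq i)

/-- **THE LIE DERIVATIVE ALONG EVERY `X ∈ 𝔲(2,2)` (the (G2.2) face, general direction).**  For an archimedean Weil datum `ω` of
`U(2,2) × U(R,S)` with vacuum clause, every continuous ℝ-linear `T : 𝓢 → V`, every `Φ ∈ 𝓢` and every `X` in the Lie algebra `𝔲(2,2)` (read in the
real vector space `↥(uFormGroup (Fin 2) (Fin 2)).lie.toSubmodule` of ★ `u22AdaptedBasis`):
`d∕dt|₀ T (ω (exp (t X), 1) Φ) = ∑ᵢ aᵢ(X) · T (dωᵢ Φ)`, `aᵢ(X) = (u22AdaptedBasis.repr X) i`, `dωᵢ Φ = κOp e (kᵢ,1) (Gᵢ (κOp e (kᵢ⁻¹,1) Φ))` the explicit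
letter derivative vectors of (G2-W2). [cite: Varadarajan1984, Thm. 2.10.1 and (2.10.19), p. 89] [cite: Folland1989, (4.24), Prop. (4.39)] -/
theorem hasDerivAt_weilDatum_expMem_smul {ω : Representation ℂ (Ginf (Fin 2) (Fin 2) R S) (SchwartzMap (DPIdx (Fin 2) (Fin 2) R S → ℝ) ℂ)}
    (hW : IsArchWeilDatum (ι𝕎 (Fin 2) (Fin 2) R S) ω) {e : VacExponents}
    (hvac : ∀ k : DPK (Fin 2) (Fin 2) R S, ω (κ (Fin 2) (Fin 2) R S k) (hermitePi 0) = vacScalar e k • hermitePi 0)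
    (T : (SchwartzMap (DPIdx (Fin 2) (Fin 2) R S → ℝ) ℂ) →L[ℝ] V) (Φ : SchwartzMap (DPIdx (Fin 2) (Fin 2) R S → ℝ) ℂ)
    (X : ↥(uFormGroup (Fin 2) (Fin 2)).lie.toSubmodule) :
    HasDerivAt (fun t : ℝ => T (ω ((((uFormGroup (Fin 2) (Fin 2)).expMem
        ⟨((t • X : ↥(uFormGroup (Fin 2) (Fin 2)).lie.toSubmodule) : Matrix (Fin 2 ⊕ Fin 2) (Fin 2 ⊕ Fin 2) ℂ), (t • X).2⟩ :
          UForm (Fin 2) (Fin 2)), (1 : UForm R S)) : Ginf (Fin 2) (Fin 2) R S) Φ))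
      (∑ i, (u22AdaptedBasis.repr X) i •
        T ((u22LetterOp R S e (u22FrameK i) (u22Kind i)).pre
          ((u22LetterOp R S e (u22FrameK i) (u22Kind i)).gen ((u22LetterOp R S e (u22FrameK i) (u22Kind i)).post Φ)))) 0 := by
  -- the smooth map `F : 𝔤 → V`, `Y ↦ T (ω (exp Y, 1) Φ)`
  let F : ↥(uFormGroup (Fin 2) (Fin 2)).lie.toSubmodule → V := fun Y =>
    T (ω ((((uFormGroup (Fin 2) (Fin 2)).expMem ⟨(Y : Matrix (Fin 2 ⊕ Fin 2) (Fin 2 ⊕ Fin 2) ℂ), Y.2⟩ : UForm (Fin 2) (Fin 2)),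
      (1 : UForm R S)) : Ginf (Fin 2) (Fin 2) R S) Φ)
  have hF : ContDiffAt ℝ ((⊤ : ℕ∞) : WithTop ℕ∞) F 0 :=
    contDiffAt_weilDatum_inl hW hvac (c := fun Y : ↥(uFormGroup (Fin 2) (Fin 2)).lie.toSubmodule =>
      (uFormGroup (Fin 2) (Fin 2)).expMem ⟨(Y : Matrix (Fin 2 ⊕ Fin 2) (Fin 2 ⊕ Fin 2) ℂ), Y.2⟩)
      ((uFormGroup (Fin 2) (Fin 2)).contDiffAt_coe_expMem_mk 0) T Φ
  have hL : HasFDerivAt F (fderiv ℝ F 0) 0 := (hF.differentiableAt (by simp)).hasFDerivAt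
  -- along every ray `t ↦ t • Y`: derivative `DF(0) Y`
  have hray : ∀ Y : ↥(uFormGroup (Fin 2) (Fin 2)).lie.toSubmodule, HasDerivAt (fun t : ℝ => F (t • Y)) (fderiv ℝ F 0 Y) 0 := fun Y => by
    have h1 : HasDerivAt (fun t : ℝ => t • Y) Y 0 := by
      have h := (hasDerivAt_id (0 : ℝ)).smul_const Y
      rwa [one_smul] at h
    have h2 : HasFDerivAt F (fderiv ℝ F 0) ((fun t : ℝ => t • Y) 0) := by
      rw [show (fun t : ℝ => t • Y) 0 = 0 from zero_smul ℝ Y]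
      exact hL
    exact h2.comp_hasDerivAt (0 : ℝ) h1
  -- on the basis vectors the derivative is the letter derivative of (G2-W2)
  have hbasis : ∀ i : Fin 16, fderiv ℝ F 0 (u22AdaptedBasis i) =
      T ((u22LetterOp R S e (u22FrameK i) (u22Kind i)).pre
        ((u22LetterOp R S e (u22FrameK i) (u22Kind i)).gen ((u22LetterOp R S e (u22FrameK i) (u22Kind i)).post Φ))) := fun i => by
    have hW2 := hasDerivAt_weilDatum_expMem_smul_u22X hW hvac i T Φ
    have heq : (fun t : ℝ => F (t • u22AdaptedBasis i)) = fun s : ℝ => T (ω ((((uFormGroup (Fin 2) (Fin 2)).expMem (s • u22X i) :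
        UForm (Fin 2) (Fin 2)), (1 : UForm R S)) : Ginf (Fin 2) (Fin 2) R S) Φ) := by
      funext t
      have hx : (⟨((t • u22AdaptedBasis i : ↥(uFormGroup (Fin 2) (Fin 2)).lie.toSubmodule) : Matrix (Fin 2 ⊕ Fin 2) (Fin 2 ⊕ Fin 2) ℂ),
          (t • u22AdaptedBasis i).2⟩ : ↥(uFormGroup (Fin 2) (Fin 2)).lie) = t • u22X i :=
        Subtype.ext (by rw [u22X_eq_mk_u22AdaptedBasis]; rfl)
      show T (ω _ Φ) = T (ω _ Φ)
      rw [← hx]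
    exact (heq ▸ hray (u22AdaptedBasis i)).unique hW2
  -- linearity of `DF(0)`
  have hsum : fderiv ℝ F 0 X = ∑ i, (u22AdaptedBasis.repr X) i •
      T ((u22LetterOp R S e (u22FrameK i) (u22Kind i)).pre
        ((u22LetterOp R S e (u22FrameK i) (u22Kind i)).gen ((u22LetterOp R S e (u22FrameK i) (u22Kind i)).post Φ))) := by
    conv_lhs => rw [← u22AdaptedBasis.sum_repr X]
    rw [map_sum]
    refine Finset.sum_congr rfl fun i _ => ?_
    rw [map_smul, hbasis i]
  rw [← hsum]
  exact hray X

/-- **THE LIE DERIVATIVE ALONG EVERY `X ∈ 𝔲(2,2)`, AS `T` OF ONE SCHWARTZ VECTOR** (the (G2.2) face in the shape `HasDerivAt (…) (T (dω X Φ)) 0`):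
with `dω X Φ := ∑ᵢ (aᵢ(X) : ℂ) • dωᵢ Φ ∈ 𝓢`, `d∕dt|₀ T (ω (exp (t X), 1) Φ) = T (dω X Φ)` — `T` is real-linear and the real coordinates `aᵢ(X)` act
through `ℝ ⊆ ℂ` (`hasDerivAt_weilDatum_expMem_smul` + `Complex.coe_smul`). [cite: Varadarajan1984, Thm. 2.10.1 and (2.10.19), p. 89]
[cite: Folland1989, (4.24), Prop. (4.39)] -/
theorem hasDerivAt_weilDatum_expMem_smul' {ω : Representation ℂ (Ginf (Fin 2) (Fin 2) R S) (SchwartzMap (DPIdx (Fin 2) (Fin 2) R S → ℝ) ℂ)}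
    (hW : IsArchWeilDatum (ι𝕎 (Fin 2) (Fin 2) R S) ω) {e : VacExponents}
    (hvac : ∀ k : DPK (Fin 2) (Fin 2) R S, ω (κ (Fin 2) (Fin 2) R S k) (hermitePi 0) = vacScalar e k • hermitePi 0)
    (T : (SchwartzMap (DPIdx (Fin 2) (Fin 2) R S → ℝ) ℂ) →L[ℝ] V) (Φ : SchwartzMap (DPIdx (Fin 2) (Fin 2) R S → ℝ) ℂ)
    (X : ↥(uFormGroup (Fin 2) (Fin 2)).lie.toSubmodule) :
    HasDerivAt (fun t : ℝ => T (ω ((((uFormGroup (Fin 2) (Fin 2)).expMem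
        ⟨((t • X : ↥(uFormGroup (Fin 2) (Fin 2)).lie.toSubmodule) : Matrix (Fin 2 ⊕ Fin 2) (Fin 2 ⊕ Fin 2) ℂ), (t • X).2⟩ :
          UForm (Fin 2) (Fin 2)), (1 : UForm R S)) : Ginf (Fin 2) (Fin 2) R S) Φ))
      (T (∑ i, (((u22AdaptedBasis.repr X) i : ℝ) : ℂ) •
        (u22LetterOp R S e (u22FrameK i) (u22Kind i)).pre
          ((u22LetterOp R S e (u22FrameK i) (u22Kind i)).gen ((u22LetterOp R S e (u22FrameK i) (u22Kind i)).post Φ)))) 0 := by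
  have h := hasDerivAt_weilDatum_expMem_smul hW hvac T Φ X
  convert h using 1
  rw [map_sum]
  refine Finset.sum_congr rfl fun i _ => ?_
  rw [Complex.coe_smul, map_smul]

end Summit.HodgeConjecture.HodgeConjecture.Cruxes.HLiu418.K2LiuWeilDatumSmoothU22

end
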